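import Literature.NumberTheory.EllipticCurves.SelmerTorsionCMOperatorJZero
import HarnessLib

/-!
# An equivariant operator on `E[n]` preserves the local kernels `ker (H¹(K, E[n]) → H¹(K_v, E[n]))`

Topic `NumberTheory/EllipticCurves`; namespace `Literature.NumberTheory.EllipticCurves`. Theorems only:
**no definition and no named fact is introduced** (D-0026). Sequel of `SelmerTorsionCMOperatorJZero`
(`resH1Hom_id_mem_selmerLocalKer`: `H¹(fn)` respects `ker (H¹(K, E[n]) → H¹(E, E))`).

For an equivariant endomorphism `fn : E[n] → E[n]` of the `n`-torsion of `E = W/K` lying over an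
`f : E(K̄) → E(K̄)` with local points maps (every `K`-isogeny: `Isogeny.hasLocalPointsMaps_toAddMonoidHom`),
the induced `w := H¹(fn)` on `H¹(K, E[n])` (`resH1Hom (ContinuousMonoidHom.id _) fn hfn`) preserves the
local kernel `WeierstrassCurve.torsionLocalKer W E n = ker (H¹(K, E[n]) → H¹(E, E(K̄_E)[n]))` at every
`K`-field `E` (`resH1Hom_id_mem_torsionLocalKer`); and when `w² + w + 1 = 0` (the CM operator `[ω]`,
`JZero.exists_cm_operator_galH1Torsion`, `resH1Hom_id_apply_apply_add`), `w` is invertible with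
inverse `-1 - w`, so membership of
the multiples `c • t` in that kernel is EQUIVALENT for `t` and `w t`
(`zsmul_resH1Hom_id_mem_torsionLocalKer_iff`).  These are the two facts that let a hypothesis set of
the shape «`t` Selmer, `2^N t = 0`, `t_q = 0` at `q ∣ m`, `2^b t ≠ 0` at `λ`» (Kolyvagin's descent,
McCallum 1991 §5, proof of Thm. 5.4) pass from `t` to `[ω] t`.

## References

* [SerreGaloisCohomology1997] J.-P. Serre, *Galois Cohomology* (1997), I.§2.4 (functoriality of
  `H¹` in compatible pairs).
* [MilneADT2006] J. S. Milne, *Arithmetic Duality Theorems*, 2nd ed. (2006), Ch. I §6 p. 75.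
* [McCallumLMS1991] W. G. McCallum, *Kolyvagin's work on Shafarevich–Tate groups* (1991), §5.
-/

noncomputable section

open scoped Classical

universe u

namespace Literature.NumberTheory.EllipticCurves

open _root_.WeierstrassCurve

section TorsionLocalKer

variable {K : Type u} [Field K] {W : WeierstrassCurve K} (n : ℤ)
variable (E : Type u) [Field E] [Algebra K E]

/-- **`H¹(fn)` respects the local kernel `ker (H¹(K, E[n]) → H¹(E, E(K̄_E)[n]))`** when `fn` lies over an
`f` with a local points map at `E` (`fE` equivariant, `fE ∘ ι = ι ∘ f`): both paths
`H¹(K, E[n]) → H¹(E, E(K̄_E)[n])` are the map of one compatible pair (sister of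
`resH1Hom_id_mem_selmerLocalKer`). Serre, *Galois Cohomology*, I.§2.4.
[cite: SerreGaloisCohomology1997, I.§2.4] [cite: MilneADT2006, Ch. I §6 p. 75] -/
theorem resH1Hom_id_mem_torsionLocalKer (fn : geomTorsion W n →+ geomTorsion W n)
    (hfn : ∀ (σ : Field.absoluteGaloisGroup K) (P : geomTorsion W n),
      fn (ContinuousMonoidHom.id _ σ • P) = σ • fn P)
    (f : W.geomPoints →+ W.geomPoints)
    (hcoe : ∀ P : geomTorsion W n, ((fn P : geomTorsion W n) : W.geomPoints) = f P)
    (fE : localPoints W E →+ localPoints W E)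
    (hfE : ∀ (τ : Field.absoluteGaloisGroup E) (P : localPoints W E), fE (τ • P) = τ • fE P)
    (hcomp : ∀ P : W.geomPoints, fE (pointsMap W E P) = pointsMap W E (f P))
    {c : galH1Torsion W n} (hc : c ∈ W.torsionLocalKer E n) :
    resH1Hom (ContinuousMonoidHom.id _) fn hfn c ∈ W.torsionLocalKer E n := by
  -- the local operator on `E(K̄_E)[n]`
  let fnE : AddSubgroup.torsionBy (localPoints W E) n →+ AddSubgroup.torsionBy (localPoints W E) n :=
    (fE.comp (AddSubgroup.torsionBy (localPoints W E) n).subtype).codRestrict _ fun P ↦ by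
      have hP : n • (P : localPoints W E) = 0 := (Submodule.mem_torsionBy_iff n _).mp P.2
      have h0 : n • fE (P : localPoints W E) = 0 := by rw [← map_zsmul, hP, map_zero]
      exact (Submodule.mem_torsionBy_iff n _).mpr h0
  have hfnE : ∀ (τ : Field.absoluteGaloisGroup E) (P : AddSubgroup.torsionBy (localPoints W E) n),
      fnE (ContinuousMonoidHom.id _ τ • P) = τ • fnE P := fun τ P ↦
    Subtype.ext (hfE τ (P : localPoints W E))
  rw [WeierstrassCurve.torsionLocalKer, resKer_eq_ker, AddMonoidHom.mem_ker] at hc ⊢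
  have key : (resH1Hom (resGal (K := K) E) (torsionPointsMap W E n)
      (torsionPointsMap_smul W E n)).comp (resH1Hom (ContinuousMonoidHom.id _) fn hfn) =
      (resH1Hom (ContinuousMonoidHom.id (Field.absoluteGaloisGroup E)) fnE hfnE).comp
        (resH1Hom (resGal (K := K) E) (torsionPointsMap W E n) (torsionPointsMap_smul W E n)) := by
    rw [resH1Hom_comp, resH1Hom_comp]
    refine resH1Hom_congr (by ext; rfl) ?_ _ _
    ext P
    change pointsMap W E ((fn P : geomTorsion W n) : W.geomPoints) = fE (pointsMap W E P)
    rw [hcoe, hcomp]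
  have hkey := congrArg (fun F : galH1Torsion W n →+ _ ↦ F c) key
  simp only [AddMonoidHom.comp_apply] at hkey
  rw [hkey, hc, map_zero]

/-- **`H¹(fn)` respects the local kernel, for an `f` with local points maps** (e.g. a `K`-isogeny,
`Isogeny.hasLocalPointsMaps_toAddMonoidHom`). [cite: MilneADT2006, Ch. I §6 p. 75] -/
theorem resH1Hom_id_mem_torsionLocalKer_of_hasLocalPointsMaps (fn : geomTorsion W n →+ geomTorsion W n)
    (hfn : ∀ (σ : Field.absoluteGaloisGroup K) (P : geomTorsion W n),
      fn (ContinuousMonoidHom.id _ σ • P) = σ • fn P)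
    (f : W.geomPoints →+ W.geomPoints)
    (hcoe : ∀ P : geomTorsion W n, ((fn P : geomTorsion W n) : W.geomPoints) = f P)
    (hloc : HasLocalPointsMaps W W f)
    {c : galH1Torsion W n} (hc : c ∈ W.torsionLocalKer E n) :
    resH1Hom (ContinuousMonoidHom.id _) fn hfn c ∈ W.torsionLocalKer E n := by
  obtain ⟨fE, hfE, hcomp⟩ := hloc E
  exact resH1Hom_id_mem_torsionLocalKer n E fn hfn f hcoe fE hfE hcomp hc

/-- **Multiples of `t` and of `w t` lie in the local kernel simultaneously** when `w = H¹(fn)`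
satisfies `w (w c) + w c + c = 0` (e.g. from `fn (fn P) + fn P + P = 0` by
`resH1Hom_id_apply_apply_add`; then `w` is invertible with inverse `-1 - w`): for every `c : ℤ`,
`c • w t ∈ ker (H¹(K, E[n]) → H¹(E, E(K̄_E)[n])) ↔ c • t ∈ ker (…)`.  This is the step that carries the
order hypothesis «`2^b t ∉ ker loc_λ`» of McCallum's Thm. 5.4 from `t` to `[ω] t`.
[cite: McCallumLMS1991, §5, proof of Thm. 5.4] [cite: SerreGaloisCohomology1997, I.§2.4] -/
theorem zsmul_resH1Hom_id_mem_torsionLocalKer_iff (fn : geomTorsion W n →+ geomTorsion W n)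
    (hfn : ∀ (σ : Field.absoluteGaloisGroup K) (P : geomTorsion W n),
      fn (ContinuousMonoidHom.id _ σ • P) = σ • fn P)
    (f : W.geomPoints →+ W.geomPoints)
    (hcoe : ∀ P : geomTorsion W n, ((fn P : geomTorsion W n) : W.geomPoints) = f P)
    (hloc : HasLocalPointsMaps W W f)
    (hrel : ∀ c, resH1Hom (ContinuousMonoidHom.id _) fn hfn (resH1Hom (ContinuousMonoidHom.id _) fn hfn c) +
      resH1Hom (ContinuousMonoidHom.id _) fn hfn c + c = 0)
    (t : galH1Torsion W n) (c : ℤ) :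
    c • resH1Hom (ContinuousMonoidHom.id _) fn hfn t ∈ W.torsionLocalKer E n ↔
      c • t ∈ W.torsionLocalKer E n := by
  set w := resH1Hom (ContinuousMonoidHom.id _) fn hfn with hw
  constructor
  · intro h
    -- `c • t = -(w (w (c • t))) - w (c • t)` and both terms lie in the kernel
    have h3 := hrel (c • t)
    have hwct : w (c • t) ∈ W.torsionLocalKer E n := by rwa [map_zsmul]
    have hwwct : w (w (c • t)) ∈ W.torsionLocalKer E n :=
      resH1Hom_id_mem_torsionLocalKer_of_hasLocalPointsMaps n E fn hfn f hcoe hloc hwct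
    have hct : c • t = -(w (w (c • t))) - w (c • t) := by
      rw [eq_sub_iff_add_eq, eq_neg_iff_add_eq_zero, ← h3]
      abel
    rw [hct]
    exact sub_mem (neg_mem hwwct) hwct
  · intro h
    rw [← map_zsmul]
    exact resH1Hom_id_mem_torsionLocalKer_of_hasLocalPointsMaps n E fn hfn f hcoe hloc h

/-- The contrapositive packaging used by the descent: `c • t ∉ ker loc ↔ c • w t ∉ ker loc`.
[cite: McCallumLMS1991, §5, proof of Thm. 5.4] -/
theorem zsmul_resH1Hom_id_not_mem_torsionLocalKer_iff (fn : geomTorsion W n →+ geomTorsion W n)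
    (hfn : ∀ (σ : Field.absoluteGaloisGroup K) (P : geomTorsion W n),
      fn (ContinuousMonoidHom.id _ σ • P) = σ • fn P)
    (f : W.geomPoints →+ W.geomPoints)
    (hcoe : ∀ P : geomTorsion W n, ((fn P : geomTorsion W n) : W.geomPoints) = f P)
    (hloc : HasLocalPointsMaps W W f)
    (hrel : ∀ c, resH1Hom (ContinuousMonoidHom.id _) fn hfn (resH1Hom (ContinuousMonoidHom.id _) fn hfn c) +
      resH1Hom (ContinuousMonoidHom.id _) fn hfn c + c = 0)
    (t : galH1Torsion W n) (c : ℤ) :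
    c • resH1Hom (ContinuousMonoidHom.id _) fn hfn t ∉ W.torsionLocalKer E n ↔
      c • t ∉ W.torsionLocalKer E n :=
  (zsmul_resH1Hom_id_mem_torsionLocalKer_iff n E fn hfn f hcoe hloc hrel t c).not

end TorsionLocalKer

end Literature.NumberTheory.EllipticCurves

end
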